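import Literature.Analysis.FunctionSpaces.HolderBallData
import HarnessLib

/-!
# `C^{m+1,α}` ball data of a map smooth near a closed ball

Topic `Literature/Analysis/FunctionSpaces`, companion of `HolderBallData.lean` (Gilbarg–Trudinger
2001, §4.1): the unbundled "`C^{n,α}` data on a ball" used by the interior regularity theory,

  `ContDiffOn ℝ n f (ball y₀ R) ∧ ∃ B, (∀ y ∈ ball, ∀ j ≤ n, ‖Dʲf(y)‖ ≤ B) ∧ [Dⁿf]_{α; ball} ≤ B`,

are automatic, for every order, for a map which is `C^∞` on an open set containing the CLOSED
ball: the derivatives are continuous on the open set, hence bounded on the compact closed ball, and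
the top one is Hölder by the mean value inequality (`holderOnWith_iteratedFDeriv_of_lt`). This is
how smooth coefficient fields enter the regularity induction of a fully nonlinear elliptic equation
(Gilbarg–Trudinger Lemma 17.16). Everything is proved; no definitions, no named facts.

## References

* D. Gilbarg, N. S. Trudinger, *Elliptic Partial Differential Equations of Second Order*,
  Classics in Mathematics, Springer 2001, §4.1 and Lemma 17.16. [GilbargTrudinger2001]
-/

noncomputable section

open Function Metric Set Filter
open scoped NNReal ContDiff Topology

namespace Literature.Analysis.FunctionSpaces

variable {E P : Type*} [NormedAddCommGroup E] [NormedSpace ℝ E] [ProperSpace E]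
  [NormedAddCommGroup P] [NormedSpace ℝ P]

/-- **`C^{m+1,α}` data on a ball for a map smooth near the closed ball.** If `c` is `C^∞` on an
open set `O ⊇ closedBall y₀ R` (`E` proper), then for every `m` it is `C^{m+1}` on `ball y₀ R`,
all derivatives of order `≤ m + 1` are bounded there by one constant `B_c`, and `D^{m+1}c` is
`α`-Hölder on the ball with the same constant (`α ≤ 1`): bounds by compactness of the closed ball
(`iteratedFDerivWithin = iteratedFDeriv` on the open set, continuous there), the Hölder bound from
the bound of `D^{m+2}c` and the mean value inequality (`holderOnWith_iteratedFDeriv_of_lt`).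
[cite: GilbargTrudinger2001, §4.1] -/
theorem holderData_succ_of_contDiffOn {c : E → P} {O : Set E} (hO : IsOpen O)
    (hc : ContDiffOn ℝ ∞ c O) {y₀ : E} {R : ℝ} (hRO : closedBall y₀ R ⊆ O) {α : ℝ≥0}
    (hα : α ≤ 1) (m : ℕ) :
    ContDiffOn ℝ (m + 1) c (ball y₀ R) ∧ ∃ Bc : ℝ≥0,
      (∀ y ∈ ball y₀ R, ∀ i ≤ m + 1, ‖iteratedFDeriv ℝ i c y‖ ≤ Bc) ∧
      HolderOnWith Bc α (iteratedFDeriv ℝ (m + 1) c) (ball y₀ R) := by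
  -- all derivatives are continuous on `O`, hence bounded on the closed ball
  have hcont : ∀ i : ℕ, ContinuousOn (iteratedFDeriv ℝ i c) (closedBall y₀ R) := by
    intro i
    have h1 : ContinuousOn (iteratedFDerivWithin ℝ i c O) O :=
      hc.continuousOn_iteratedFDerivWithin (m := i) (WithTop.coe_le_coe.2 le_top) hO.uniqueDiffOn
    exact (h1.mono hRO).congr fun y hy => ((iteratedFDerivWithin_of_isOpen i hO) (hRO hy)).symm
  have hbd : ∀ i : ℕ, ∃ B : ℝ, ∀ y ∈ closedBall y₀ R, ‖iteratedFDeriv ℝ i c y‖ ≤ B := fun i =>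
    (isCompact_closedBall y₀ R).exists_bound_of_continuousOn (hcont i)
  choose B hB using hbd
  -- one constant for the orders `≤ m + 2`
  set Bt : ℝ := ∑ i ∈ Finset.range (m + 3), |B i| with hBt
  have hBt_le : ∀ i ≤ m + 2, ∀ y ∈ ball y₀ R, ‖iteratedFDeriv ℝ i c y‖ ≤ Bt := by
    intro i hi y hy
    refine ((hB i y (ball_subset_closedBall hy)).trans (le_abs_self _)).trans ?_
    exact Finset.single_le_sum (f := fun i => |B i|) (fun i _ => abs_nonneg _)
      (Finset.mem_range.2 (by omega))
  have hbO : ball y₀ R ⊆ O := ball_subset_closedBall.trans hRO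
  have hcd : ContDiffOn ℝ ((m + 2 : ℕ) : WithTop ℕ∞) c (ball y₀ R) :=
    (hc.of_le (WithTop.coe_le_coe.2 le_top)).mono hbO
  have hlt : m + 1 < m + 2 := by omega
  -- the Hölder bound of `D^{m+1}c` from the bound of `D^{m+2}c`
  have hH1 := holderOnWith_iteratedFDeriv_of_lt hcd hlt (B := Bt.toNNReal)
    (fun y hy => (hBt_le (m + 2) le_rfl y hy).trans (Real.le_coe_toNNReal _)) hα
  have hle : ((m + 1 : ℕ) : WithTop ℕ∞) ≤ ((m + 2 : ℕ) : WithTop ℕ∞) :=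
    WithTop.coe_le_coe.2 (by exact_mod_cast (by omega : m + 1 ≤ m + 2))
  refine ⟨?_, Bt.toNNReal + Bt.toNNReal * (2 * R.toNNReal) ^ (1 - (α : ℝ)), fun y hy i hi => ?_,
    hH1.mono_const le_add_self⟩
  · have h := hcd.of_le hle
    exact_mod_cast h
  · exact ((hBt_le i (by omega) y hy).trans (Real.le_coe_toNNReal _)).trans
      (by exact_mod_cast le_self_add)

end Literature.Analysis.FunctionSpaces

end
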